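import Mathlib.Algebra.Polynomial.Bivariate
import Mathlib.Algebra.Polynomial.Inductions
import Mathlib.Algebra.Polynomial.Roots
import Mathlib.Algebra.Polynomial.RingDivision
import Mathlib.Algebra.Polynomial.Degree.Lemmas
import Mathlib.Algebra.Polynomial.Degree.TrailingDegree
import Mathlib.Algebra.Polynomial.Eval.Degree
import Mathlib.Logic.Equiv.Fin.Basic
import Literature.Computability.MetaComplexity.ListDecodableCodeSudan
import HarnessLib

/-!
# Sudan's list RECOVERY bound for Reed–Solomon codes and Roth–Ruckenstein root finding

Topic `Literature/InformationTheory/Coding`. Two classical ingredients of list decoding of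
Reed–Solomon codes, over an arbitrary field `K` (finite where counting is involved), proved from
Mathlib's polynomial algebra (`K[X]`, bivariate `K[X][Y] = Polynomial (Polynomial K)`) on top of the
interpolation lemmas of `Literature/Computability/MetaComplexity/ListDecodableCodeSudan.lean`
(`LDC.exists_kernel_vec`, `LDC.bivOfCoeffs`, `LDC.HasShape`, `LDC.natDegree_eval_le`,
`LDC.eval_eq_zero_of_card_lt`):

* **Sudan's lemma in list-recovery form** (M. Sudan, *Decoding of Reed Solomon codes beyond the
  error-correction bound*, J. Complexity 13 (1997), §2, Claims 3–4 and Thm. 5 — here in the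
  unweighted `(I, J)`-shape of Arora–Barak's presentation, as in `ListDecodableCodeSudan.lean` — and
  in the form with a SET `S_b` of admissible values at each position `b`, as used by C. Umans,
  JCSS 67 (2003), Lemma 15 and §6.2): for position sets `S : K → Finset K`
  with `Σ_b |S_b| < I · J` there is a nonzero `Q ∈ K[X][Y]` of `X`-degree `< I` and `Y`-degree `< J`
  vanishing at every pair `(b, v)`, `v ∈ S_b` (`SudanRR.exists_interpolant`); every `f` of degree
  `≤ D` with `f(b) ∈ S_b` for more than `(I-1) + (J-1)·D` positions `b` is a `Y`-root of `Q`
  (`SudanRR.eval_eq_zero_of_agree`); hence there are at most `J - 1` such `f`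
  (`SudanRR.card_le_of_agree` — the combinatorial list bound, algorithm-free).
* **Roth–Ruckenstein root finding** (R. M. Roth, G. Ruckenstein, *Efficient decoding of
  Reed–Solomon codes beyond half the minimum distance*, IEEE Trans. Inform. Theory 46 (2000)
  246–257, §V, the recursive procedure `Reconstruct` of Fig. 2, Lemma 5.1 and Prop. 5.2; §VI,
  Lemma 6.2 and Prop. 6.4; held text checked): the `Y`-roots `f ∈ K[X]` of degree `≤ D` of a
  nonzero `Q ∈ K[X][Y]` are found coefficient by coefficient — `f₀` is a root of `Q₀(0, Y)` where
  `Q₀ = Q / X^k` is `Q` stripped of its `X`-content power (`SudanRR.stripX`), and `f₁ = (f - f₀)/X`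
  is a `Y`-root of `Q₀(X, XY + f₀)` (`SudanRR.childQ`). `SudanRR.pathsL elems t Q` lists the
  coefficient paths of length `t` of this recursion, branching at each node over the roots in a
  given enumeration `elems` of the field (characteristic-free: no derivatives, unlike Newton–Hensel
  lifting, which needs simple roots); **completeness** `SudanRR.ofFn_coeff_mem_pathsL` (every
  `Y`-root of degree `< t` is listed) and the **width bound** `SudanRR.length_pathsL_le` (at most
  `max 1 (deg_Y Q)` paths at every depth, Prop. 6.4, by Roth–Ruckenstein's multiplicity count
  Lemma 6.2, `SudanRR.natDegree_atZero_child_le`: the `Y`-degree of `Q_γ(0, Y)` for the child at a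
  root `γ` is at most the multiplicity of `γ`, and multiplicities of distinct roots add up to at most
  the degree).

Everything is a definition with a body or a theorem; no named fact. These are the decoding core of
Umans' reconstruction procedure (JCSS 2003, Lemma 17) in characteristic `2`, where Newton lifting
from a simple point (`LDC.newton_step`, which needs `char K > deg_Y Q`) is unavailable.

## References

* M. Sudan, *Decoding of Reed Solomon codes beyond the error-correction bound*, J. Complexity 13
  (1997) 180–193, §2, Claims 2–4, Thm. 5 [Sudan1997] (held text `paper:doi-10-1006-jcom-1997-0439`).
* R. M. Roth, G. Ruckenstein, *Efficient decoding of Reed–Solomon codes beyond half the minimum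
  distance*, IEEE Trans. Inform. Theory 46 (2000) 246–257, §V (Fig. 2, Lemma 5.1, Prop. 5.2), §VI
  (Lemma 6.2, Prop. 6.4) [RothRuckenstein2000] (held text `paper:doi-10-1109-18-817522`, checked).
* V. Guruswami, *List Decoding of Error-Correcting Codes*, LNCS 3282, Springer 2005 (monograph
  treatment of list recovery and of the root-finding step) [Guruswami2005].
* S. Arora, B. Barak, *Computational Complexity: A Modern Approach*, CUP 2009, §19 (Sudan's list
  decoding of Reed–Solomon codes in the unweighted shape) [AroraBarakCC2009].
* C. Umans, *Pseudo-random generators for all hardnesses*, J. Comput. System Sci. 67 (2003)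
  419–440, Lemma 15 and §6.2 [Umans2003].
-/

noncomputable section

namespace Literature.InformationTheory.Coding

open Polynomial Finset
open scoped Polynomial.Bivariate
open Literature.Computability.MetaComplexity

namespace SudanRR

variable {K : Type*} [Field K]

/-! ### Sudan's lemma in list-recovery form -/

section Recovery

variable [Fintype K] [DecidableEq K]

/-- The **agreement** of a polynomial `f` with position sets `S`: the number of positions `b`
with `f(b) ∈ S_b`. [cite: Sudan1997, §2 (condition (1), the agreement parameter `t`)] -/
def agree (S : K → Finset K) (f : K[X]) : ℕ := #{b : K | f.eval b ∈ S b}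

/-- **Interpolation step** (list-recovery form): if the total number of pairs `(b, v)`, `v ∈ S_b`,
is less than `I · J`, some nonzero `Q ∈ K[X][Y]` of `X`-degree `< I` and `Y`-degree `< J` vanishes
at all of them (a homogeneous linear system in the `I · J` coefficients with fewer equations than
unknowns; Sudan's Claims 2–3 in the unweighted shape). [cite: Sudan1997, §2, Claim 3] -/
theorem exists_interpolant (S : K → Finset K) {I J : ℕ} (h : ∑ b, (S b).card < I * J) :
    ∃ Q : K[X][Y], Q ≠ 0 ∧ LDC.HasShape I J Q ∧ ∀ b, ∀ v ∈ S b, Q.evalEval b v = 0 := by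
  classical
  -- the constraints, indexed by `Fin P`
  set P : ℕ := ∑ b, (S b).card with hP
  let prs : Finset (Σ _ : K, K) := univ.sigma S
  have hcard : prs.card = P := by rw [hP, card_sigma]
  have hfin : Fintype.card prs = P := by rw [Fintype.card_coe, hcard]
  let e : prs ≃ Fin P := Fintype.equivFinOfCardEq hfin
  -- the linear system: unknowns `Fin (I * J) ≃ Fin I × Fin J`
  let A : Fin P → Fin (I * J) → K := fun t u =>
    ((e.symm t).1.1) ^ ((finProdFinEquiv.symm u).1 : ℕ) * ((e.symm t).1.2) ^ ((finProdFinEquiv.symm u).2 : ℕ)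
  obtain ⟨w, hw0, hw⟩ := LDC.exists_kernel_vec A h
  let c : ℕ → ℕ → K := fun i j =>
    if hij : i < I ∧ j < J then w (finProdFinEquiv (⟨i, hij.1⟩, ⟨j, hij.2⟩)) else 0
  refine ⟨LDC.bivOfCoeffs I J c, ?_, LDC.hasShape_bivOfCoeffs I J c, fun b v hv => ?_⟩
  · -- nonzero: some coordinate of `w` is nonzero
    obtain ⟨u, hu⟩ : ∃ u, w u ≠ 0 := by
      by_contra hall
      push Not at hall
      exact hw0 (funext hall)
    set ij := finProdFinEquiv.symm u with hij
    refine LDC.bivOfCoeffs_ne_zero (i := (ij.1 : ℕ)) (j := (ij.2 : ℕ)) ij.1.2 ij.2.2 ?_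
    have : c ij.1 ij.2 = w u := by
      simp only [c, dif_pos (And.intro ij.1.2 ij.2.2), Fin.eta]
      rw [show ((ij.1, ij.2) : Fin I × Fin J) = ij from rfl, hij, Equiv.apply_symm_apply]
    rw [this]; exact hu
  · -- vanishing at the pair `(b, v)`: the equation of index `e ⟨⟨b, v⟩, _⟩`
    have hmem : (⟨b, v⟩ : Σ _ : K, K) ∈ prs := by
      rw [Finset.mem_sigma]; exact ⟨mem_univ _, hv⟩
    have heq := hw (e ⟨⟨b, v⟩, hmem⟩)
    rw [LDC.evalEval_bivOfCoeffs]
    -- rewrite the double `range` sum as a sum over `Fin (I * J)`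
    have h1 : ∑ j ∈ range J, ∑ i ∈ range I, c i j * b ^ i * v ^ j =
        ∑ p : Fin I × Fin J, c p.1 p.2 * b ^ (p.1 : ℕ) * v ^ (p.2 : ℕ) := by
      rw [Finset.sum_comm, ← Fin.sum_univ_eq_sum_range (fun i => ∑ j ∈ range J, c i j * b ^ i * v ^ j) I]
      simp_rw [← Fin.sum_univ_eq_sum_range (fun j => c _ j * b ^ _ * v ^ j) J]
      rw [← Finset.univ_product_univ, Finset.sum_product]
    have h2 : ∑ p : Fin I × Fin J, c p.1 p.2 * b ^ (p.1 : ℕ) * v ^ (p.2 : ℕ) =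
        ∑ u : Fin (I * J), A (e ⟨⟨b, v⟩, hmem⟩) u * w u := by
      rw [← Equiv.sum_comp finProdFinEquiv.symm]
      refine sum_congr rfl fun u _ => ?_
      simp only [A, Equiv.symm_apply_apply]
      have hc : c ((finProdFinEquiv.symm u).1 : ℕ) ((finProdFinEquiv.symm u).2 : ℕ) = w u := by
        simp only [c, dif_pos (And.intro (finProdFinEquiv.symm u).1.2 (finProdFinEquiv.symm u).2.2),
          Fin.eta, Prod.mk.eta, Equiv.apply_symm_apply]
      rw [hc]; ring
    rw [h1, h2]; exact heq

/-- **Sudan's identity in list-recovery form**: if `Q` of shape `(I, J)` vanishes at all pairs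
`(b, v)`, `v ∈ S_b`, then every `f` of degree `≤ D` whose agreement with `S` exceeds
`(I - 1) + (J - 1) · D` satisfies `Q(X, f(X)) = 0` (the univariate `Q(X, f(X))` has degree at most
that bound and a root at every agreeing position). [cite: Sudan1997, §2, Claim 4] -/
theorem eval_eq_zero_of_agree {S : K → Finset K} {I J D : ℕ} {Q : K[X][Y]}
    (hQ : LDC.HasShape I J Q) (hvan : ∀ b, ∀ v ∈ S b, Q.evalEval b v = 0)
    {f : K[X]} (hf : f.natDegree ≤ D) (hA : (I - 1) + (J - 1) * D < agree S f) :
    Q.eval f = 0 := by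
  refine LDC.eval_eq_zero_of_card_lt ({b : K | f.eval b ∈ S b} : Finset K) (fun β hβ => ?_) ?_
  · exact hvan β _ (mem_filter.1 hβ).2
  · have h1 := LDC.natDegree_eval_le (n := D + 1) hQ (p := f) (by simpa using hf)
    simp only [Nat.add_sub_cancel] at h1
    exact lt_of_le_of_lt h1 hA

/-- **Sudan's list bound (list-recovery form)**: with `Q` as in `exists_interpolant`, the
polynomials of degree `≤ D` with agreement `> (I - 1) + (J - 1) · D` are `Y`-roots of the nonzero
`Q ∈ (K[X])[Y]`, so there are at most `deg_Y Q ≤ J - 1` of them ("the number of such polynomials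
is at most the `y`-degree of `Q`"). [cite: Sudan1997, §2, Thm. 5] -/
theorem card_le_of_agree {S : K → Finset K} {I J D : ℕ} {Q : K[X][Y]} (hQ0 : Q ≠ 0)
    (hQ : LDC.HasShape I J Q) (hvan : ∀ b, ∀ v ∈ S b, Q.evalEval b v = 0)
    (T : Finset K[X]) (hT : ∀ f ∈ T, f.natDegree ≤ D ∧ (I - 1) + (J - 1) * D < agree S f) :
    T.card ≤ J - 1 := by
  classical
  have hsub : T ⊆ Q.roots.toFinset := fun f hf => by
    rw [Multiset.mem_toFinset, mem_roots hQ0, IsRoot.def]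
    exact eval_eq_zero_of_agree hQ hvan (hT f hf).1 (hT f hf).2
  have hdeg : Q.natDegree ≤ J - 1 := by
    have h1 := hQ.1
    rw [degree_eq_natDegree hQ0] at h1
    have h2 : Q.natDegree < J := by exact_mod_cast h1
    omega
  calc T.card ≤ Q.roots.toFinset.card := card_le_card hsub
    _ ≤ Multiset.card Q.roots := Multiset.toFinset_card_le _
    _ ≤ Q.natDegree := card_roots' Q
    _ ≤ J - 1 := hdeg

/-- **The list-recovery lemma, assembled**: for position sets with fewer than `I · J` pairs in
total, the polynomials of degree `≤ D` agreeing with `S` on more than `(I - 1) + (J - 1) · D`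
positions number at most `J - 1`. [cite: Sudan1997, §2, Thm. 5; Umans2003, Lemma 15] -/
theorem card_le_of_agree' (S : K → Finset K) {I J D : ℕ} (h : ∑ b, (S b).card < I * J)
    (T : Finset K[X]) (hT : ∀ f ∈ T, f.natDegree ≤ D ∧ (I - 1) + (J - 1) * D < agree S f) :
    T.card ≤ J - 1 := by
  obtain ⟨Q, hQ0, hQ, hvan⟩ := exists_interpolant S h
  exact card_le_of_agree hQ0 hQ hvan T hT

end Recovery

/-! ### `Q(0, Y)`, division of the coefficients by `X`, and the `X`-content power -/

/-- **`Q(0, Y)`**: the univariate polynomial of the constant terms of the coefficients of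
`Q ∈ K[X][Y]`. [cite: RothRuckenstein2000, §V, Lemma 5.1 (the polynomials `M_i(0, y)` whose
roots are the coefficients `g_i`)] -/
def atZero (Q : K[X][Y]) : K[X] := Q.map (evalRingHom 0)

/-- Coefficients of `Q(0, Y)`. [folklore] -/
theorem coeff_atZero (Q : K[X][Y]) (j : ℕ) : (atZero Q).coeff j = (Q.coeff j).coeff 0 := by
  rw [atZero, coeff_map, coe_evalRingHom, coeff_zero_eq_eval_zero]

/-- `Q(0, Y)` evaluated at `v` is `Q(0, v)`. [folklore] -/
theorem eval_atZero (Q : K[X][Y]) (v : K) : (atZero Q).eval v = Q.evalEval 0 v := by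
  rw [atZero, map_evalRingHom_eval]

/-- `atZero 0 = 0`. [folklore] -/
@[simp] theorem atZero_zero : atZero (0 : K[X][Y]) = 0 := by simp [atZero]

/-- The `Y`-degree of `Q(0, Y)` is at most that of `Q`. [folklore] -/
theorem natDegree_atZero_le (Q : K[X][Y]) : (atZero Q).natDegree ≤ Q.natDegree :=
  natDegree_map_le

/-- **Division of every coefficient by `X`** (dropping the constant terms):
`Σ_j q_j(X) Yʲ ↦ Σ_j (q_j(X) - q_j(0))/X · Yʲ`. [cite: RothRuckenstein2000, §V, Lemma 5.1
(`M_i = x^{-r_i} Q_i`, removal of the `x`-power content)] -/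
def cdivX (Q : K[X][Y]) : K[X][Y] := Q.sum fun n a => monomial n (divX a)

/-- Coefficients of `cdivX`. [folklore] -/
theorem coeff_cdivX (Q : K[X][Y]) (j : ℕ) : (cdivX Q).coeff j = divX (Q.coeff j) := by
  classical
  rw [cdivX, Polynomial.sum, finsetSum_coeff]
  simp_rw [coeff_monomial]
  rw [Finset.sum_ite_eq']
  split_ifs with h
  · rfl
  · rw [notMem_support_iff.1 h, divX_zero]

/-- `cdivX 0 = 0`. [folklore] -/
@[simp] theorem cdivX_zero : cdivX (0 : K[X][Y]) = 0 := by
  ext j n; rw [coeff_cdivX, coeff_zero, divX_zero]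

/-- Coefficients of iterated `cdivX`. [folklore] -/
theorem coeff_iterate_cdivX (k : ℕ) : ∀ (Q : K[X][Y]) (j : ℕ),
    (cdivX^[k] Q).coeff j = divX^[k] (Q.coeff j) := by
  induction k with
  | zero => intro Q j; rfl
  | succ k ih => intro Q j; rw [Function.iterate_succ_apply, ih, coeff_cdivX, ← Function.iterate_succ_apply]

/-- Coefficients of iterated `divX`. [folklore] -/
theorem coeff_iterate_divX (k : ℕ) : ∀ (a : K[X]) (n : ℕ), (divX^[k] a).coeff n = a.coeff (n + k) := by
  induction k with
  | zero => intro a n; rfl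
  | succ k ih =>
    intro a n
    rw [Function.iterate_succ_apply', coeff_divX, ih, Nat.add_right_comm, Nat.add_assoc]

/-- Iterated `cdivX` of `0` is `0`. [folklore] -/
@[simp] theorem iterate_cdivX_zero (k : ℕ) : cdivX^[k] (0 : K[X][Y]) = 0 := by
  induction k with
  | zero => rfl
  | succ k ih => rw [Function.iterate_succ_apply, cdivX_zero, ih]

/-- If `Q(0, Y) = 0` then `Q = X · cdivX Q`. [folklore] -/
theorem eq_C_X_mul_cdivX {Q : K[X][Y]} (h : atZero Q = 0) : Q = C X * cdivX Q := by
  ext j n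
  rw [coeff_C_mul, coeff_cdivX]
  have h0 : (Q.coeff j).coeff 0 = 0 := by rw [← coeff_atZero, h, coeff_zero]
  have h1 := divX_mul_X_add (Q.coeff j)
  rw [h0, C_0, add_zero] at h1
  conv_lhs => rw [← h1]
  rw [mul_comm]

/-- The `Y`-degree does not increase under `cdivX`. [folklore] -/
theorem natDegree_cdivX_le (Q : K[X][Y]) : (cdivX Q).natDegree ≤ Q.natDegree := by
  refine (natDegree_le_iff_coeff_eq_zero).2 fun N hN => ?_
  rw [coeff_cdivX, coeff_eq_zero_of_natDegree_lt hN, divX_zero]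

/-- The `Y`-degree does not increase under iterated `cdivX`. [folklore] -/
theorem natDegree_iterate_cdivX_le (k : ℕ) : ∀ Q : K[X][Y], (cdivX^[k] Q).natDegree ≤ Q.natDegree := by
  induction k with
  | zero => intro Q; exact le_rfl
  | succ k ih => intro Q; rw [Function.iterate_succ_apply]; exact (ih _).trans (natDegree_cdivX_le Q)

/-- A nonzero `Q` has, after finitely many divisions by `X`, a nonzero `Q(0, Y)`. [folklore] -/
theorem exists_atZero_iterate_ne {Q : K[X][Y]} (hQ : Q ≠ 0) : ∃ k, atZero (cdivX^[k] Q) ≠ 0 := by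
  obtain ⟨j, hj⟩ : ∃ j, Q.coeff j ≠ 0 := by
    by_contra hall
    push Not at hall
    exact hQ (Polynomial.ext fun j => by rw [hall j, coeff_zero])
  refine ⟨(Q.coeff j).natTrailingDegree, fun h => ?_⟩
  have h1 := congrArg (fun p : K[X] => p.coeff j) h
  simp only [coeff_atZero, coeff_iterate_cdivX, coeff_iterate_divX, zero_add, coeff_zero] at h1
  exact (coeff_natTrailingDegree_ne_zero.2 hj) h1

open Classical in
/-- **The `X`-content exponent**: the least `k` such that `Q / X^k` has a nonzero `Q(0, Y)`
(`0` for `Q = 0`). [cite: RothRuckenstein2000, §V, Lemma 5.1 (`r_i` = the largest integer such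
that `x^{r_i}` divides `Q_i`)] -/
def xval (Q : K[X][Y]) : ℕ := if h : Q = 0 then 0 else Nat.find (exists_atZero_iterate_ne h)

/-- **`Q` stripped of its `X`-content power**: `Q / X^{xval Q}` (Roth–Ruckenstein's
`M_i(x, y) = x^{-r_i} Q_i(x, y)`). [cite: RothRuckenstein2000, §V, Lemma 5.1] -/
def stripX (Q : K[X][Y]) : K[X][Y] := cdivX^[xval Q] Q

/-- `stripX 0 = 0`. [folklore] -/
@[simp] theorem stripX_zero : stripX (0 : K[X][Y]) = 0 := by simp [stripX]

/-- `xval 0 = 0`. [folklore] -/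
@[simp] theorem xval_zero : xval (0 : K[X][Y]) = 0 := by simp [xval]

/-- The stripped polynomial of `Q ≠ 0` has a nonzero `Q(0, Y)` ("while `M_i(0, y) ≠ 0`").
[cite: RothRuckenstein2000, §V, Lemma 5.1] -/
theorem atZero_stripX_ne_zero {Q : K[X][Y]} (hQ : Q ≠ 0) : atZero (stripX Q) ≠ 0 := by
  classical
  rw [stripX, xval, dif_neg hQ]
  exact Nat.find_spec (exists_atZero_iterate_ne hQ)

/-- Minimality of `xval`. [folklore] -/
theorem xval_le_of_ne {Q : K[X][Y]} (hQ : Q ≠ 0) {k : ℕ} (hk : atZero (cdivX^[k] Q) ≠ 0) : xval Q ≤ k := by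
  classical
  rw [xval, dif_neg hQ]
  exact Nat.find_min' _ hk

/-- Below `xval`, `Q(0, Y)` vanishes. [folklore] -/
theorem atZero_iterate_eq_zero_of_lt {Q : K[X][Y]} {k : ℕ} (hk : k < xval Q) : atZero (cdivX^[k] Q) = 0 := by
  classical
  by_cases hQ : Q = 0
  · subst hQ; simp
  · rw [xval, dif_neg hQ] at hk
    have := Nat.find_min (exists_atZero_iterate_ne hQ) hk
    push Not at this
    exact this

/-- **`Q = X^{xval Q} · stripX Q`.** [cite: RothRuckenstein2000, §V, Lemma 5.1] -/
theorem eq_pow_mul_stripX (Q : K[X][Y]) : Q = C X ^ xval Q * stripX Q := by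
  suffices h : ∀ k ≤ xval Q, Q = C X ^ k * (cdivX^[k] Q) from h _ le_rfl
  intro k hk
  induction k with
  | zero => simp
  | succ k ih =>
    have h1 := ih (Nat.le_of_succ_le hk)
    have h2 : atZero (cdivX^[k] Q) = 0 := atZero_iterate_eq_zero_of_lt hk
    have h3 := eq_C_X_mul_cdivX h2
    calc Q = C X ^ k * (cdivX^[k] Q) := h1
      _ = C X ^ k * (C X * cdivX (cdivX^[k] Q)) := by rw [← h3]
      _ = C X ^ (k + 1) * (cdivX^[k + 1] Q) := by rw [Function.iterate_succ_apply', pow_succ, mul_assoc]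

/-- `stripX Q ≠ 0` for `Q ≠ 0`. [folklore] -/
theorem stripX_ne_zero {Q : K[X][Y]} (hQ : Q ≠ 0) : stripX Q ≠ 0 := fun h =>
  atZero_stripX_ne_zero hQ (by rw [h, atZero_zero])

/-- The `Y`-degree does not increase under stripping. [folklore] -/
theorem natDegree_stripX_le (Q : K[X][Y]) : (stripX Q).natDegree ≤ Q.natDegree :=
  natDegree_iterate_cdivX_le _ _

/-- **`Y`-roots are unchanged by stripping**: `(stripX Q)(X, f(X)) = 0 ↔ Q(X, f(X)) = 0`
(`X^k` is a nonzero polynomial of the domain `K[X]`). [cite: RothRuckenstein2000, §V, Lemma 5.1] -/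
theorem eval_stripX_eq_zero_iff (Q : K[X][Y]) (f : K[X]) : (stripX Q).eval f = 0 ↔ Q.eval f = 0 := by
  conv_rhs => rw [eq_pow_mul_stripX Q]
  rw [eval_mul, eval_pow, eval_C, mul_eq_zero, or_iff_right]
  exact pow_ne_zero _ X_ne_zero

/-! ### The Roth–Ruckenstein recursion -/

/-- **The substitution `Y ↦ X · Y + γ`**: `Q(X, XY + γ)` (Roth–Ruckenstein's
`Q_{i+1}(x, y) = M_i(x, xy + g_i)`). [cite: RothRuckenstein2000, §V, Lemma 5.1] -/
def shiftY (Q : K[X][Y]) (γ : K) : K[X][Y] := Q.comp (C X * Y + CC γ)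

/-- `Q(X, XY + γ)` at `Y = g(X)` is `Q(X, X g(X) + γ)`. [folklore] -/
theorem eval_shiftY (Q : K[X][Y]) (γ : K) (g : K[X]) : (shiftY Q γ).eval g = Q.eval (X * g + C γ) := by
  rw [shiftY, eval_comp]
  simp [CC]

/-- The substitution keeps nonzero polynomials nonzero. [folklore] -/
theorem shiftY_ne_zero {Q : K[X][Y]} (hQ : Q ≠ 0) (γ : K) : shiftY Q γ ≠ 0 := by
  intro h
  rw [shiftY, comp_eq_zero_iff] at h
  rcases h with h | ⟨-, h⟩
  · exact hQ h
  · have h1 := congrArg (fun p : K[X][Y] => p.coeff 1) h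
    simp [CC] at h1

/-- **The child at a root `γ`**: `Q₀(X, XY + γ)` with `Q₀ = stripX Q` (the recursive call of
`Reconstruct`, Fig. 2). [cite: RothRuckenstein2000, §V, Lemma 5.1 and Fig. 2] -/
def childQ (Q : K[X][Y]) (γ : K) : K[X][Y] := shiftY (stripX Q) γ

/-- Children of nonzero polynomials are nonzero. [folklore] -/
theorem childQ_ne_zero {Q : K[X][Y]} (hQ : Q ≠ 0) (γ : K) : childQ Q γ ≠ 0 :=
  shiftY_ne_zero (stripX_ne_zero hQ) γ

open Classical in
/-- **Roth–Ruckenstein's coefficient paths.** `pathsL elems t Q` lists the sequences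
`[f₀, f₁, …, f_{t-1}]` produced by `t` levels of the recursion "`f₀` a root of `Q₀(0, Y)`
(`Q₀ = stripX Q`), then recurse on `Q₀(X, XY + f₀)`", the roots at each node being searched in
the given enumeration `elems` of field elements (for the zero polynomial the list is empty).
[cite: RothRuckenstein2000, §V, Fig. 2 (procedure `Reconstruct`)] -/
def pathsL (elems : List K) : ℕ → K[X][Y] → List (List K)
  | 0, _ => [[]]
  | t + 1, Q =>
    if Q = 0 then []
    else ((elems.filter fun γ => decide ((atZero (stripX Q)).eval γ = 0)).flatMap
      fun γ => (pathsL elems t (childQ Q γ)).map (List.cons γ))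

/-- `pathsL` at depth `0`. [folklore] -/
@[simp] theorem pathsL_zero (elems : List K) (Q : K[X][Y]) : pathsL elems 0 Q = [[]] := rfl

open Classical in
/-- `pathsL` at depth `t + 1` for `Q ≠ 0`. [folklore] -/
theorem pathsL_succ_of_ne (elems : List K) (t : ℕ) {Q : K[X][Y]} (hQ : Q ≠ 0) :
    pathsL elems (t + 1) Q = ((elems.filter fun γ => decide ((atZero (stripX Q)).eval γ = 0)).flatMap
      fun γ => (pathsL elems t (childQ Q γ)).map (List.cons γ)) := by
  rw [pathsL, if_neg hQ]

/-- `pathsL` at depth `t + 1` for `Q = 0`. [folklore] -/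
@[simp] theorem pathsL_succ_zero (elems : List K) (t : ℕ) : pathsL elems (t + 1) (0 : K[X][Y]) = [] := by
  rw [pathsL, if_pos rfl]

/-- Dividing by `X` lowers the degree below `t` when the degree was below `t + 1`. [folklore] -/
theorem degree_divX_lt_of_lt {f : K[X]} {t : ℕ} (h : f.degree < (t + 1 : ℕ)) : f.divX.degree < (t : ℕ) := by
  by_cases hf : f = 0
  · subst hf; simp
  · have h1 : f.natDegree < t + 1 := by
      rw [degree_eq_natDegree hf] at h; exact_mod_cast h
    by_cases hd : f.divX = 0
    · rw [hd, degree_zero]; exact WithBot.bot_lt_coe _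
    · rw [degree_eq_natDegree hd, natDegree_divX_eq_natDegree_tsub_one]
      have h2 : f.natDegree ≠ 0 := by
        intro h0
        apply hd
        rw [eq_C_of_natDegree_eq_zero h0, divX_C]
      exact_mod_cast (show f.natDegree - 1 < t by omega)

/-- **Completeness of Roth–Ruckenstein**: every `Y`-root `f` of a nonzero `Q` with `deg f < t`
has its coefficient sequence `[f₀, …, f_{t-1}]` among the paths of depth `t`, provided `elems`
enumerates the whole field. (`f = f₀ + X f₁`; `Q(X, f) = 0` gives `Q₀(X, f) = 0` for the stripped
`Q₀`, whence `Q₀(0, f₀) = 0`, and `f₁` is a `Y`-root of `Q₀(X, XY + f₀)` of smaller degree.)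
[cite: RothRuckenstein2000, §V, Lemma 5.1 and Prop. 5.2] -/
theorem ofFn_coeff_mem_pathsL {elems : List K} (helems : ∀ γ : K, γ ∈ elems) :
    ∀ (t : ℕ) (Q : K[X][Y]) (f : K[X]), Q ≠ 0 → Q.eval f = 0 → f.degree < (t : ℕ) →
      List.ofFn (fun i : Fin t => f.coeff i) ∈ pathsL elems t Q
  | 0, Q, f, _, _, _ => by simp
  | t + 1, Q, f, hQ, hev, hdeg => by
    classical
    rw [pathsL_succ_of_ne elems t hQ, List.mem_flatMap]
    have hf : f = X * f.divX + C (f.coeff 0) := by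
      conv_lhs => rw [← divX_mul_X_add f]
      ring
    have hQ₀ : stripX Q ≠ 0 := stripX_ne_zero hQ
    have hev₀ : (stripX Q).eval f = 0 := (eval_stripX_eq_zero_iff Q f).2 hev
    have hroot : (atZero (stripX Q)).eval (f.coeff 0) = 0 := by
      rw [eval_atZero, ← LDC.coeff_zero_eval, hev₀, coeff_zero]
    refine ⟨f.coeff 0, List.mem_filter.2 ⟨helems _, by simpa using hroot⟩,
      List.mem_map.2 ⟨List.ofFn fun i : Fin t => f.divX.coeff i, ?_, ?_⟩⟩
    · exact ofFn_coeff_mem_pathsL helems t (childQ Q (f.coeff 0)) f.divX (childQ_ne_zero hQ _)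
        (by rw [childQ, eval_shiftY, ← hf]; exact hev₀) (degree_divX_lt_of_lt hdeg)
    · rw [List.ofFn_succ]
      congr 1
      exact List.ofFn_inj.2 (funext fun i => by rw [Fin.val_succ, coeff_divX])

/-! ### The width of the recursion tree (Roth–Ruckenstein's multiplicity count) -/

/-- **The multiplicity count.** For `Q ≠ 0` with stripped part `Q₀` and a root `γ` of
`P = Q₀(0, Y)`, the polynomial `Q_γ(0, Y)` of the (stripped) child `Q_γ = Q₀(X, XY + γ)` has
degree at most the multiplicity of `γ` as a root of `P`. (Write `Q₀(X, Y + γ) = Σ_j h_j(X) Yʲ`;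
the multiplicity `μ` is the least `j` with `h_j(0) ≠ 0`; `Q₀(X, XY + γ) = Σ_j h_j(X) Xʲ Yʲ` has
`X`-content exponent `k ≤ μ`, and after division by `X^k` only the terms `j ≤ k` keep a constant
term.) [cite: RothRuckenstein2000, §VI, Lemma 6.2] -/
theorem natDegree_atZero_child_le {Q : K[X][Y]} (hQ : Q ≠ 0) (γ : K) :
    (atZero (stripX (childQ Q γ))).natDegree ≤ rootMultiplicity γ (atZero (stripX Q)) := by
  classical
  set Q₀ := stripX Q with hQ₀def
  set P := atZero Q₀ with hPdef
  have hQ₀ : Q₀ ≠ 0 := stripX_ne_zero hQ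
  have hP : P ≠ 0 := atZero_stripX_ne_zero hQ
  -- the `Y`-translate `R = Q₀(X, Y + γ)` and its relation to the child
  set R : K[X][Y] := Q₀.comp (Y + CC γ) with hRdef
  have hchild : childQ Q γ = R.comp (C X * Y) := by
    rw [childQ, ← hQ₀def, shiftY, hRdef, Polynomial.comp_assoc]
    congr 1
    simp [CC, add_comp]
  have hcoeff : ∀ j, (childQ Q γ).coeff j = R.coeff j * X ^ j := fun j => by
    rw [hchild, comp_C_mul_X_coeff]
  -- `R(0, Y) = P(Y + γ)`, whose trailing degree is the multiplicity `μ`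
  have hR0 : atZero R = P.comp (X + C γ) := by
    rw [hPdef, atZero, atZero, hRdef, map_comp]
    congr 1
    simp [CC]
  set μ := rootMultiplicity γ P with hμdef
  have hμ : μ = (atZero R).natTrailingDegree := by rw [hμdef, rootMultiplicity_eq_natTrailingDegree, hR0]
  have hR0ne : atZero R ≠ 0 := by rw [hR0]; exact (comp_X_add_C_eq_zero_iff).not.2 hP
  have hRμ : (R.coeff μ).coeff 0 ≠ 0 := by
    rw [← coeff_atZero, hμ]
    exact coeff_natTrailingDegree_ne_zero.2 hR0ne
  -- the content exponent `k` of the child is at most `μ`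
  have hchild0 : childQ Q γ ≠ 0 := childQ_ne_zero hQ γ
  have hk : xval (childQ Q γ) ≤ μ := by
    refine xval_le_of_ne hchild0 fun h => hRμ ?_
    have h1 := congrArg (fun p : K[X] => p.coeff μ) h
    simp only [coeff_atZero, coeff_iterate_cdivX, coeff_iterate_divX, zero_add, coeff_zero, hcoeff] at h1
    rwa [coeff_mul_X_pow', if_pos le_rfl, Nat.sub_self] at h1
  -- and `Q_γ(0, Y)` (after stripping) has no terms above `k`
  refine le_trans ((natDegree_le_iff_coeff_eq_zero).2 fun N hN => ?_) hk
  rw [stripX, coeff_atZero, coeff_iterate_cdivX, coeff_iterate_divX, zero_add, hcoeff, coeff_mul_X_pow',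
    if_neg (not_le.2 hN)]

/-- **Width bound of Roth–Ruckenstein**: at every depth the number of coefficient paths is at most
`max 1 (deg Q₀(0, Y))`, in particular at most `max 1 (deg_Y Q)` — the children at the distinct roots
`γ` of `P = Q₀(0, Y)` have `deg Q_γ(0, Y) ≤ mult_γ(P)` and `Σ_γ mult_γ(P) ≤ deg P`. Requires the
enumeration `elems` to be duplicate-free. [cite: RothRuckenstein2000, §VI, Prop. 6.4 (with
Lemma 6.2: "the number of output polynomials produced by Reconstruct is at most `ℓ`")] -/
theorem length_pathsL_le_atZero {elems : List K} (hnd : elems.Nodup) :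
    ∀ (t : ℕ) (Q : K[X][Y]), (pathsL elems t Q).length ≤ max 1 (atZero (stripX Q)).natDegree
  | 0, Q => by simp
  | t + 1, Q => by
    classical
    by_cases hQ : Q = 0
    · subst hQ; simp
    set P := atZero (stripX Q) with hPdef
    have hP : P ≠ 0 := atZero_stripX_ne_zero hQ
    rw [pathsL_succ_of_ne elems t hQ, List.length_flatMap]
    set L := elems.filter fun γ => decide (P.eval γ = 0) with hLdef
    have hLnd : L.Nodup := hnd.filter _
    have hLroots : ∀ γ ∈ L, γ ∈ P.roots.toFinset := fun γ hγ => by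
      rw [Multiset.mem_toFinset, mem_roots hP, IsRoot.def]
      simpa using (List.mem_filter.1 hγ).2
    -- each child contributes at most the multiplicity of its root
    have hterm : ∀ γ ∈ L, ((pathsL elems t (childQ Q γ)).map (List.cons γ)).length ≤ rootMultiplicity γ P := by
      intro γ hγ
      rw [List.length_map]
      refine (length_pathsL_le_atZero hnd t (childQ Q γ)).trans (max_le ?_ ?_)
      · exact (rootMultiplicity_pos hP).2 ((mem_roots hP).1 (Multiset.mem_toFinset.1 (hLroots γ hγ)))
      · exact natDegree_atZero_child_le hQ γ
    calc (L.map (List.length ∘ fun γ => (pathsL elems t (childQ Q γ)).map (List.cons γ))).sum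
        ≤ (L.map fun γ => rootMultiplicity γ P).sum := by
          refine List.sum_le_sum ?_
          intro γ hγ
          exact hterm γ hγ
      _ = ∑ γ ∈ L.toFinset, rootMultiplicity γ P := (List.sum_toFinset _ hLnd).symm
      _ ≤ ∑ γ ∈ P.roots.toFinset, rootMultiplicity γ P :=
          Finset.sum_le_sum_of_subset fun γ hγ => hLroots γ (List.mem_toFinset.1 hγ)
      _ = Multiset.card P.roots := by
          rw [← Multiset.toFinset_sum_count_eq]
          exact Finset.sum_congr rfl fun γ _ => (count_roots P).symm
      _ ≤ P.natDegree := card_roots' P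
      _ ≤ max 1 P.natDegree := le_max_right _ _

/-- **Width bound** in terms of the `Y`-degree of `Q`: at most `max 1 (deg_Y Q)` coefficient paths
at every depth. [cite: RothRuckenstein2000, §VI, Prop. 6.4] -/
theorem length_pathsL_le {elems : List K} (hnd : elems.Nodup) (t : ℕ) (Q : K[X][Y]) :
    (pathsL elems t Q).length ≤ max 1 Q.natDegree :=
  (length_pathsL_le_atZero hnd t Q).trans
    (max_le_max le_rfl ((natDegree_atZero_le _).trans (natDegree_stripX_le Q)))

/-! ### Reading the roots off the paths -/

/-- The polynomial with a given coefficient list: `[c₀, c₁, …] ↦ Σ cᵢ Xⁱ`. [folklore] -/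
def ofCoeffs (l : List K) : K[X] := ∑ i ∈ range l.length, C (l.getD i 0) * X ^ i

/-- A polynomial of degree `≤ D` is read back from its first `D + 1` coefficients. [folklore] -/
theorem ofCoeffs_ofFn_coeff {f : K[X]} {D : ℕ} (hf : f.natDegree ≤ D) :
    ofCoeffs (List.ofFn fun i : Fin (D + 1) => f.coeff i) = f := by
  rw [ofCoeffs, List.length_ofFn]
  conv_rhs => rw [as_sum_range_C_mul_X_pow' f (Nat.lt_succ_of_le hf)]
  refine sum_congr rfl fun i hi => ?_
  congr 2
  rw [List.getD_eq_getElem?_getD, List.getElem?_ofFn]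
  simp [mem_range.1 hi]

/-- **Roth–Ruckenstein finds every root of bounded degree**: for `Q ≠ 0` and a `Y`-root `f` with
`deg f ≤ D`, some path of depth `D + 1` is the coefficient list of `f` (and `ofCoeffs` reads `f`
back from it); together with `length_pathsL_le`, the `Y`-roots of degree `≤ D` are among at most
`max 1 (deg_Y Q)` explicitly listed candidates. [cite: RothRuckenstein2000, §V, Prop. 5.2; §VI, Prop. 6.4] -/
theorem exists_mem_pathsL_ofCoeffs_eq {elems : List K} (helems : ∀ γ : K, γ ∈ elems) {D : ℕ}
    {Q : K[X][Y]} (hQ : Q ≠ 0) {f : K[X]} (hf : f.natDegree ≤ D) (hev : Q.eval f = 0) :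
    ∃ l ∈ pathsL elems (D + 1) Q, ofCoeffs l = f := by
  refine ⟨_, ofFn_coeff_mem_pathsL helems (D + 1) Q f hQ hev ?_, ofCoeffs_ofFn_coeff hf⟩
  by_cases h0 : f = 0
  · subst h0; simp
  · rw [degree_eq_natDegree h0]; exact_mod_cast Nat.lt_succ_of_le hf

end SudanRR

end Literature.InformationTheory.Coding

end
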